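import Summits.QuantumFields.YangMills.Theorems.BalabanUVNodesPortZDStepUnit

/-!
# NODE O port, row PT-A′ helper lane (PTZ-1, gen 3): [I] (2.12)–(2.14) — THE STRUCTURE OF THE HISTORY CHANNEL, generic over `Node00/ZeroInputStepT`:
# `𝓓_{k+1}` is the LOG-MOMENT OF THE HISTORY FLUCTUATION `𝐄_k − 𝐄_k(Ū^k U_{k+1} W)` under the step, normalised «at `U_{k+1} = 1`»; window rows
# (fibre-constant history ⇒ no channel; monotone window ⇒ the channel is bounded by the bracket's oscillation on `supp χ_k ∩ window`)

[Balaban1987RG1] = [I] (CMP 109, 1987): (0.19) p. 255–256 («the constant 𝐍_k is given by the integral above with V = 1»), (0.22) p. 256, (1.6) p. 261,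
(2.1) p. 265, (2.10) p. 267, (2.12)–(2.13) p. 268 («Let us notice that the normalization constant N_k^z is equal to the integral above at U_{k+1} = 1. The
expression under the exponential is clearly a sum of two terms, one is connected with the expansion of the action −(1∕g_k²)A(U_k(V)) and the measure in (2.1) …
another is the expression in the curly bracket {…}»), (2.14) p. 268 («the expression under the exponential above vanishes at g_k = 0»);
[Balaban1988RG2Cluster] = [II] (CMP 116, 1988): Lemma 3 (2.38) p. 20, p. 21 («C₃ = 2(L+2)⁴O(1)·2E₀·C₁…», «O(1)C₃ε₁ ≤ ½E₀»).

Seat `ymgap-nodeO-port-PTZ-1` g3 (prover, HELPER MODE; `--supports stmt-QuantumFields-27930 --as helper`; nothing keyed to 26648 here).  CRIT-1 Q-5 (β): every row is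
cut over the χ-GENERIC layer — `χ`, `GF`, `T`, the bound action `A`, the history `E`, `ε`, `K`, `g`, `k` BOUND; the structural properties of `T` a row uses (degree-one
homogeneity = this seat's gen-0 `hT` of `PortZD.nextAction_add_const`; locality resp. monotonicity through a WINDOW `S W` of fine fields) are DISPLAYED; 0 tokens of the
χ-cone of record.  Companion of `…PortZDStepRows` (✓p797663: `stepOutT_add_sub`, `integrand_add_const`, pencil ends) and `…PortZDStepUnit` (✓p797859: `EkT_one`).

WHAT IS PROVED (0 sorry; no `def` ∕ `instance` ∕ `notation`; `R_k(A) := ZeroInput.stepOutT … A`, `𝐓(A) := B12Eq019ActionBody.nextAction T χ GF g A`,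
`I(A) := B12Eq019ActionBody.integrand χ GF g A = χ·e^{−GF∕g² + A}`, `bg_W := Ū^k U_{k+1} W`):
* §1 (2.12)–(2.13) AS AN IDENTITY.  `integrand_add_recentre` — `I(A + E) = e^{c} · I(A + (E − c))` for every constant `c`; ★ `nextAction_add_sub_eq_log_recentre` —
  for `T` degree-one homogeneous and the two steps defined (the four transformed densities positive at `V` and at `1`), and ANY two re-centring constants `c, c′`:
  `𝐓(A + E)(V) − 𝐓(A)(V) = log[T(I(A + (E − c)))(V) ∕ T(I(A))(V)] − log[T(I(A + (E − c′)))(1) ∕ T(I(A))(1)] + (c − c′)`;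
  ★★ `stepOutT_add_sub_eq_log_fluct` — with `c := E(bg_W)`, `c′ := E(bg_1)`: `R_k(A + E)(W) − R_k(A)(W) = log⟨e^{E − E(bg_W)}⟩^A_W − log⟨e^{E − E(bg_1)}⟩^A_1 − E(bg_1)`,
  where `⟨e^{F}⟩^A_V := T(I(A + F))(V) ∕ T(I(A))(V)` is the moment functional of the `A`-step at `V` — THE HISTORY RESPONSE IS THE LOG-MOMENT OF PRINT'S CURLY
  BRACKET `{E(·) − E(background)}` (zero at zero fluctuation, (2.14)) UNDER THE `A`-STEP, NORMALISED «AT U_{k+1} = 1» (p. 268);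
  ★★ `dChannel_eq_log_fluct` — the instance `A := A⁰_k`, `E := 𝐄_k`: `𝓓_{k+1}(W) = 𝓝_{k+1}(W) − 𝓝⁰_{k+1}(W) = log⟨e^{𝐄_k − 𝐄_k(bg_W)}⟩⁰_W − log⟨e^{𝐄_k − 𝐄_k(bg_1)}⟩⁰_1
  − 𝐄_k(bg_1)` (the ZERO-INPUT step's moment functional); `EkT_iter_Uk_one_of_gaugeInvariant` — `𝐄_k(bg_1) = 0` given `GaugeInvariant A_k` (displayed, as in
  `PortZD.mergedTermT_one_of_gaugeInvariant`), whence ★★ `dChannel_eq_log_fluct_of_gaugeInvariant` — `𝓓_{k+1}(W) = log⟨e^{𝐄_k − 𝐄_k(bg_W)}⟩⁰_W − log[𝐍_k(A_k) ∕ 𝐍_k(A⁰_k)]`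
  exactly (at `W = 1` the bracket is `𝐄_k` itself: the moment is the ratio of the two (0.19) normalisation constants, print's `N_k ∕ N_k^z`).
* §2 (2.14) AS A VANISHING ROW.  `transport_integrand_congr_window` ∕ ★ `stepOutT_add_sub_eq_of_windowConst` — for `T K k` LOCAL through windows (`ρ = ρ′` on `S W` ⇒
  `T ρ W = T ρ′ W`, displayed at `W` and at `1`): a history CONSTANT on `S W ∩ supp χ_k` (value `E(bg_W)`) and on `S 1 ∩ supp χ_k` (value `E(bg_1)`) has
  `R_k(A + E)(W) − R_k(A)(W) = −E(bg_1)` — no response beyond the normalisation (generalises gen 0's `stepOutT_add_of_vanish`: fibre-constant instead of zero;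
  the `A`-step's integrals at `W`, `1` non-zero); `dChannel_eq_zero_of_windowConst` — `𝓓_{k+1}(W) = 0` for a window-constant `𝐄_k` with `GaugeInvariant A_k`.
* §3 [II] LEMMA 3's MECHANISM AT FUNCTIONAL LEVEL.  `transport_integrand_window_le` ∕ `_ge` — for `T K k` MONOTONE through the window (`ρ ≤ ρ′` on `S W` ⇒
  `T ρ W ≤ T ρ′ W`, displayed) and `0 ≤ χ_k`: `|F| ≤ η` on `S W ∩ supp χ_k` squeezes `e^{−η}·T(I(A))(W) ≤ T(I(A + F))(W) ≤ e^{η}·T(I(A))(W)`;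
  `abs_log_moment_le_of_window` — hence `|log⟨e^F⟩^A_W| ≤ η` when `T(I(A))(W) > 0`; ★★ `abs_stepOutT_add_sub_le_of_window` —
  `|R_k(A + E)(W) − R_k(A)(W) + E(bg_1)| ≤ η_W + η_1` from the bracket's oscillations `η_W` on `S W ∩ supp χ_k` and `η_1` on `S 1 ∩ supp χ_k`;
  ★★ `abs_dChannel_le_of_window` — `|𝓓_{k+1}(W)| ≤ η_W + η_1` given `GaugeInvariant A_k` (print: on the small-field window `|B′| < ε₁` the bracket is `O(ε₁)` times
  the size of 𝐄_k's derivative — the `C₃ε₁`, `C₃ ∝ E₀` of [II] p. 21; here `η` is DISPLAYED, nothing of that estimate is claimed).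
LOCATED (said, not claimed): at the record `TβOfRecord₁₃ = TcanOfRecord` has the three displayed properties only where its a.e.-class is pointwise determined
(`regSetOfRecord`, node00 (F1)–(F3)); the kernel transform `transportOfRecord` has them for integrable densities (window = the averaging fibre, a.e.).  No record instance here.
HONEST FRAMING.  Log algebra and order bookkeeping over the tree's definitions (`Real.log_mul`, `Real.exp_le_exp`, `div_le_iff₀`); the structural properties of `T`, the
positivity of the step integrals, `GaugeInvariant A_k` and the oscillation bounds `η` are HYPOTHESES displayed by name; NOTHING of Bałaban's estimates is asserted,
ported or discharged; no named fact introduced; 26648 ∕ 27930⁸ SIGNED·OPEN (content-gated), 27931 OPEN (RC-3), 27932 CLOSED; K0⁷ ∕ K-Ax OPEN; counts unmoved;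
finite 𝕋⁴ at fixed ε — NOT continuum ∕ OS ∕ Clay; the Yang–Mills mass gap is NOT proved by any of this.  No `sorry`, no `instance`, no `notation`, no `def`.
-/

noncomputable section

namespace Summit.QuantumFields.YangMills.Theorems.PortZD

open Literature.MathematicalPhysics.QuantumFieldTheory.Balaban1983to89
open Literature.MathematicalPhysics.QuantumFieldTheory.Balaban1983to89.Node00
open Literature.MathematicalPhysics.QuantumFieldTheory.Balaban1983to89.Node00.ZeroInput
open Summit.QuantumFields.YangMills.BalabanUVNodes.N09FlatSectorUniqueness (orbitRel_one_Uk_one)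
open B15Claim189UnitTestAtRecord (iter_avOfRecord_one)
open T4Continuum (T4Family)
open B12Eq019ActionBody (nextAction nextAction_apply normConst normConst_def integrand integrand_apply)
open B16Sect1Backgrounds (iter_gaugeAct)
open GaugeField (gaugeAct GaugeInvariant)

/-! ## §1. (2.12)–(2.13) as an identity: the history response is the log-moment of the history FLUCTUATION, normalised at the unit -/

section Generic

variable {P : Params} {G : Type*} {k : ℕ}

/-- Re-centring the input: `χ·e^{−GF∕g² + (A + E)} = e^{c} · χ·e^{−GF∕g² + (A + (E − c))}` for every constant `c` (this seat's `integrand_add_const` read at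
`A + (E − c)`). [cite: Balaban1987RG1, (0.19) p.255 (bookkeeping)] -/
theorem integrand_add_recentre (χ GF : Density P k G) (gk : ℝ) (A E : Density P k G) (c : ℝ) :
    integrand χ GF gk (A + E) = fun U => Real.exp c * integrand χ GF gk (A + fun U => E U - c) U := by
  rw [← integrand_add_const]
  congr 1
  funext U
  simp only [Pi.add_apply]
  ring

/-- For a degree-one homogeneous transport the transformed density re-centres the same way: `T(I(A + E))(V) = e^{c} · T(I(A + (E − c)))(V)`.
[cite: Balaban1987RG1, (0.13) p.254, (0.19) p.255 (bookkeeping)] -/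
theorem transport_integrand_add_recentre {T : Density P k G → Density P (k + 1) G}
    (hT : ∀ (a : ℝ) (ρ : Density P k G), T (fun U => a * ρ U) = fun V => a * T ρ V)
    (χ GF : Density P k G) (gk : ℝ) (A E : Density P k G) (c : ℝ) (V : GaugeField P (k + 1) G) :
    T (integrand χ GF gk (A + E)) V = Real.exp c * T (integrand χ GF gk (A + fun U => E U - c)) V := by
  rw [integrand_add_recentre χ GF gk A E c, hT]

/-- ★ **(2.12)–(2.13) AS AN IDENTITY, generic re-centring.**  For `T` degree-one homogeneous, the `A`-step and the `(A + E)`-step defined at `V` and at `1` (the four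
transformed densities positive), and ANY constants `c, c′`:
`𝐓(A + E)(V) − 𝐓(A)(V) = log[T(I(A + (E − c)))(V) ∕ T(I(A))(V)] − log[T(I(A + (E − c′)))(1) ∕ T(I(A))(1)] + (c − c′)` — the factors `e^{c}`, `e^{c′}` leave the
logarithms, the normalisation «𝐍 = the integral above with V = 1» supplies the second moment. [cite: Balaban1987RG1, (0.19) p.255–256, (2.12)–(2.13) p.268] -/
theorem nextAction_add_sub_eq_log_recentre [GaugeGroup G] {T : Density P k G → Density P (k + 1) G}
    (hT : ∀ (a : ℝ) (ρ : Density P k G), T (fun U => a * ρ U) = fun V => a * T ρ V)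
    (χ GF : Density P k G) (gk : ℝ) (A E : Density P k G) (c c' : ℝ) (V : GaugeField P (k + 1) G)
    (hAV : 0 < T (integrand χ GF gk A) V) (hA1 : 0 < T (integrand χ GF gk A) 1)
    (hEV : 0 < T (integrand χ GF gk (A + E)) V) (hE1 : 0 < T (integrand χ GF gk (A + E)) 1) :
    nextAction T χ GF gk (A + E) V - nextAction T χ GF gk A V =
      Real.log (T (integrand χ GF gk (A + fun U => E U - c)) V / T (integrand χ GF gk A) V) -
        Real.log (T (integrand χ GF gk (A + fun U => E U - c')) 1 / T (integrand χ GF gk A) 1) + (c - c') := by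
  have hV := transport_integrand_add_recentre hT χ GF gk A E c V
  have h1 := transport_integrand_add_recentre hT χ GF gk A E c' 1
  -- the re-centred integrals are positive
  have hXV : 0 < T (integrand χ GF gk (A + fun U => E U - c)) V := by
    have h := hEV; rw [hV] at h
    exact pos_of_mul_pos_right h (Real.exp_pos c).le
  have hX1 : 0 < T (integrand χ GF gk (A + fun U => E U - c')) 1 := by
    have h := hE1; rw [h1] at h
    exact pos_of_mul_pos_right h (Real.exp_pos c').le
  rw [nextAction_apply, nextAction_apply, normConst_def, normConst_def, hV, h1,
    Real.log_mul (inv_ne_zero (mul_pos (Real.exp_pos c') hX1).ne') (mul_pos (Real.exp_pos c) hXV).ne',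
    Real.log_inv, Real.log_mul (Real.exp_pos c').ne' hX1.ne', Real.log_mul (Real.exp_pos c).ne' hXV.ne', Real.log_exp, Real.log_exp,
    Real.log_mul (inv_ne_zero hA1.ne') hAV.ne', Real.log_inv, Real.log_div hXV.ne' hAV.ne', Real.log_div hX1.ne' hA1.ne']
  ring

end Generic

variable (F : T4Family) (N : ℕ) [NeZero N]

/-- ★★ **THE HISTORY RESPONSE OF THE STEP FUNCTIONAL IS THE LOG-MOMENT OF THE HISTORY FLUCTUATION** ((2.12)–(2.13) with «N_k^z equal to the integral above at
U_{k+1} = 1»): for `T K k` degree-one homogeneous and the two steps defined at `W` and at `1`,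
`R_k(A + E)(W) − R_k(A)(W) = log[T(I(A + (E − E(bg_W))))(W) ∕ T(I(A))(W)] − log[T(I(A + (E − E(bg_1))))(1) ∕ T(I(A))(1)] − E(bg_1)`, `bg_W := Ū^k U_{k+1} W` — the
curly bracket `E(·) − E(bg_W)` is print's `{𝐄_k(U_k(B̃′U_{k+1})) − 𝐄_k(U_{k+1})}`, zero at zero fluctuation ((2.14)).
[cite: Balaban1987RG1, (1.6) p.261, (2.12)–(2.14) p.268] -/
theorem stepOutT_add_sub_eq_log_fluct (T : Transport F N) (χ : (K : ℕ) → (ℕ → ℝ) → (k : ℕ) → Density (F.P K) k (SU N)) (ε : ℝ) (K : ℕ)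
    (g : ℕ → ℝ) (k : ℕ) (hT : ∀ (a : ℝ) (ρ : Density (F.P K) k (SU N)), T K k (fun U => a * ρ U) = fun V => a * T K k ρ V)
    (A E : Density (F.P K) k (SU N)) (W : GaugeField (F.P K) (k + 1) (SU N))
    (hAW : 0 < T K k (integrand (χ K g k) (gfOfRecord F N K k) (g k) A) W)
    (hA1 : 0 < T K k (integrand (χ K g k) (gfOfRecord F N K k) (g k) A) 1)
    (hEW : 0 < T K k (integrand (χ K g k) (gfOfRecord F N K k) (g k) (A + E)) W)
    (hE1 : 0 < T K k (integrand (χ K g k) (gfOfRecord F N K k) (g k) (A + E)) 1) :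
    stepOutT F N T χ ε K g k (A + E) W - stepOutT F N T χ ε K g k A W =
      Real.log (T K k (integrand (χ K g k) (gfOfRecord F N K k) (g k)
          (A + fun U => E U - E (Averaging.iter (avOfRecord F N K) k (Uk F N K (k + 1) ε W)))) W /
        T K k (integrand (χ K g k) (gfOfRecord F N K k) (g k) A) W) -
      Real.log (T K k (integrand (χ K g k) (gfOfRecord F N K k) (g k)
          (A + fun U => E U - E (Averaging.iter (avOfRecord F N K) k (Uk F N K (k + 1) ε 1)))) 1 /
        T K k (integrand (χ K g k) (gfOfRecord F N K k) (g k) A) 1) -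
      E (Averaging.iter (avOfRecord F N K) k (Uk F N K (k + 1) ε 1)) := by
  rw [stepOutT_add_sub, nextAction_add_sub_eq_log_recentre hT (χ K g k) (gfOfRecord F N K k) (g k) A E
    (E (Averaging.iter (avOfRecord F N K) k (Uk F N K (k + 1) ε W))) (E (Averaging.iter (avOfRecord F N K) k (Uk F N K (k + 1) ε 1)))
    W hAW hA1 hEW hE1]
  ring

/-- ★★ **`𝓓_{k+1}` IS THE LOG-MOMENT OF THE HISTORY FLUCTUATION UNDER THE ZERO-INPUT STEP**: with `A := A⁰_k` (`ZeroInput.mainTermT`) and `E := 𝐄_k` (`ZeroInput.EkT`),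
`𝓝_{k+1}(W) − 𝓝⁰_{k+1}(W) = log[T(I(A⁰_k + (𝐄_k − 𝐄_k(bg_W))))(W) ∕ T(I(A⁰_k))(W)] − log[T(I(A⁰_k + (𝐄_k − 𝐄_k(bg_1))))(1) ∕ T(I(A⁰_k))(1)] − 𝐄_k(bg_1)` — print's
`E^{(k+1)} = log ∫ dμ χ_k exp[P^{(k)} + {…}]` read against the zero-input measure: the channel is `log⟨e^{{…}}⟩⁰_W − log⟨e^{{…}}⟩⁰_1` up to the unit normalisation of 𝐄_k.
[cite: Balaban1987RG1, (0.22) p.256, (1.6) p.261, (2.12)–(2.14) p.268] -/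
theorem dChannel_eq_log_fluct (T : Transport F N) (χ : (K : ℕ) → (ℕ → ℝ) → (k : ℕ) → Density (F.P K) k (SU N)) (ε : ℝ) (K : ℕ)
    (g : ℕ → ℝ) (k : ℕ) (hT : ∀ (a : ℝ) (ρ : Density (F.P K) k (SU N)), T K k (fun U => a * ρ U) = fun V => a * T K k ρ V)
    (W : GaugeField (F.P K) (k + 1) (SU N))
    (h0W : 0 < T K k (integrand (χ K g k) (gfOfRecord F N K k) (g k) (mainTermT F N ε K g k)) W)
    (h01 : 0 < T K k (integrand (χ K g k) (gfOfRecord F N K k) (g k) (mainTermT F N ε K g k)) 1)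
    (hW : 0 < T K k (integrand (χ K g k) (gfOfRecord F N K k) (g k) (effActionHT F N T χ K g k)) W)
    (h1 : 0 < T K k (integrand (χ K g k) (gfOfRecord F N K k) (g k) (effActionHT F N T χ K g k)) 1) :
    mergedTermT F N T χ ε K g k W - zeroInputMergedTermT F N T χ ε K g k W =
      Real.log (T K k (integrand (χ K g k) (gfOfRecord F N K k) (g k)
          (mainTermT F N ε K g k + fun U => EkT F N T χ ε K g k U -
            EkT F N T χ ε K g k (Averaging.iter (avOfRecord F N K) k (Uk F N K (k + 1) ε W)))) W /
        T K k (integrand (χ K g k) (gfOfRecord F N K k) (g k) (mainTermT F N ε K g k)) W) -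
      Real.log (T K k (integrand (χ K g k) (gfOfRecord F N K k) (g k)
          (mainTermT F N ε K g k + fun U => EkT F N T χ ε K g k U -
            EkT F N T χ ε K g k (Averaging.iter (avOfRecord F N K) k (Uk F N K (k + 1) ε 1)))) 1 /
        T K k (integrand (χ K g k) (gfOfRecord F N K k) (g k) (mainTermT F N ε K g k)) 1) -
      EkT F N T χ ε K g k (Averaging.iter (avOfRecord F N K) k (Uk F N K (k + 1) ε 1)) := by
  rw [effActionHT_eq_main_add_Ek_fun F N T χ ε K g k] at hW h1
  rw [mergedTermT_eq_stepOut, effActionHT_eq_main_add_Ek_fun F N T χ ε K g k, zeroInputMergedTermT_eq_stepOut]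
  exact stepOutT_add_sub_eq_log_fluct F N T χ ε K g k hT _ _ W h0W h01 hW h1

/-- **`𝐄_k(Ū^k U_{k+1}(1)) = 0` GIVEN `GaugeInvariant A_k`** (`ε > 0`, `k + 1 ≤ m + K`): `U_{k+1}(1) = 1^u` with `u` residual (`orbitRel_one_Uk_one`), `Ū^k(1^u) = 1^{u↾}`
(`iter_gaugeAct`, `iter_avOfRecord_one`), `A_k` and `A(U_k(·))` do not see the coarse gauge transformation (`hinv`, `PortZD.wilsonAction4_Uk_gaugeAct`), and `𝐄_k(1) = 0`
(`PortZD.EkT_one`).  The invariance of `A_k` is DISPLAYED (CRIT-1 Q-5 (β); cf. `PortZD.mergedTermT_one_of_gaugeInvariant`). [cite: Balaban1987RG1, (0.22) p.256, (2.16) p.269] -/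
theorem EkT_iter_Uk_one_of_gaugeInvariant (T : Transport F N) (χ : (K : ℕ) → (ℕ → ℝ) → (k : ℕ) → Density (F.P K) k (SU N)) {ε : ℝ}
    (hε : 0 < ε) {K : ℕ} (g : ℕ → ℝ) {k : ℕ} (hk : k + 1 ≤ (F.P K).m + (F.P K).K) (hinv : GaugeInvariant (effActionHT F N T χ K g k)) :
    EkT F N T χ ε K g k (Averaging.iter (avOfRecord F N K) k (Uk F N K (k + 1) ε 1)) = 0 := by
  obtain ⟨u, -, hEq⟩ := orbitRel_one_Uk_one (F := F) (N := N) (ε := ε) hk hε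
  have hk' : k ≤ (F.P K).m + (F.P K).K := Nat.le_of_succ_le hk
  rw [hEq, iter_gaugeAct (avOfRecord F N K) u _ k hk', iter_avOfRecord_one F N K k]
  unfold EkT
  rw [hinv, wilsonAction4_Uk_gaugeAct hk']
  exact EkT_one F N T χ hε K g k

/-- ★★ **`𝓓_{k+1}(W) = log⟨e^{𝐄_k − 𝐄_k(bg_W)}⟩⁰_W − log[𝐍_k(A_k) ∕ 𝐍_k(A⁰_k)]` EXACTLY** — `dChannel_eq_log_fluct` with the unit normalisation `𝐄_k(Ū^k U_{k+1}(1)) = 0`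
(`GaugeInvariant A_k` displayed, `ε > 0`, `k + 1 ≤ m + K`): at `W = 1` the bracket is `𝐄_k` itself and the moment is the RATIO OF THE TWO NORMALISATION CONSTANTS
(`B12Eq019ActionBody.normConst` of the `A_k`-step over that of the zero-input step — print's `N_k ∕ N_k^z`). [cite: Balaban1987RG1, (0.19) p.255–256, (1.6) p.261, (2.12)–(2.14) p.268, (2.16) p.269] -/
theorem dChannel_eq_log_fluct_of_gaugeInvariant (T : Transport F N) (χ : (K : ℕ) → (ℕ → ℝ) → (k : ℕ) → Density (F.P K) k (SU N))
    {ε : ℝ} (hε : 0 < ε) {K : ℕ} (g : ℕ → ℝ) {k : ℕ} (hk : k + 1 ≤ (F.P K).m + (F.P K).K)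
    (hT : ∀ (a : ℝ) (ρ : Density (F.P K) k (SU N)), T K k (fun U => a * ρ U) = fun V => a * T K k ρ V)
    (hinv : GaugeInvariant (effActionHT F N T χ K g k)) (W : GaugeField (F.P K) (k + 1) (SU N))
    (h0W : 0 < T K k (integrand (χ K g k) (gfOfRecord F N K k) (g k) (mainTermT F N ε K g k)) W)
    (h01 : 0 < T K k (integrand (χ K g k) (gfOfRecord F N K k) (g k) (mainTermT F N ε K g k)) 1)
    (hW : 0 < T K k (integrand (χ K g k) (gfOfRecord F N K k) (g k) (effActionHT F N T χ K g k)) W)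
    (h1 : 0 < T K k (integrand (χ K g k) (gfOfRecord F N K k) (g k) (effActionHT F N T χ K g k)) 1) :
    mergedTermT F N T χ ε K g k W - zeroInputMergedTermT F N T χ ε K g k W =
      Real.log (T K k (integrand (χ K g k) (gfOfRecord F N K k) (g k)
          (mainTermT F N ε K g k + fun U => EkT F N T χ ε K g k U -
            EkT F N T χ ε K g k (Averaging.iter (avOfRecord F N K) k (Uk F N K (k + 1) ε W)))) W /
        T K k (integrand (χ K g k) (gfOfRecord F N K k) (g k) (mainTermT F N ε K g k)) W) -
      Real.log (normConst (T K k) (χ K g k) (gfOfRecord F N K k) (g k) (effActionHT F N T χ K g k) /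
        normConst (T K k) (χ K g k) (gfOfRecord F N K k) (g k) (mainTermT F N ε K g k)) := by
  have h0 := EkT_iter_Uk_one_of_gaugeInvariant F N T χ hε g hk hinv
  have h := dChannel_eq_log_fluct F N T χ ε K g k hT W h0W h01 hW h1
  have hfun : (mainTermT F N ε K g k + fun U => EkT F N T χ ε K g k U - 0) = effActionHT F N T χ K g k := by
    funext U; rw [Pi.add_apply, sub_zero, effActionHT_eq_main_add_Ek]
  rw [h0, sub_zero, hfun] at h
  exact h

/-! ## §2. (2.14) as a vanishing row: a history constant on the windows has no response beyond the normalisation -/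

section Window

variable {P : Params} {G : Type*} {k : ℕ}

/-- Through a window `S V` on which `T` is local, the transformed density of `A + F` with `F = 0` on `S V ∩ supp χ` is that of `A`.
[cite: Balaban1987RG1, (0.19) p.255, (2.14) p.268 (bookkeeping)] -/
theorem transport_integrand_congr_window {T : Density P k G → Density P (k + 1) G} {S : Set (GaugeField P k G)} {V : GaugeField P (k + 1) G}
    (hloc : ∀ ρ ρ' : Density P k G, (∀ U ∈ S, ρ U = ρ' U) → T ρ V = T ρ' V)
    (χ GF : Density P k G) (gk : ℝ) (A F : Density P k G) (hF : ∀ U ∈ S, χ U ≠ 0 → F U = 0) :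
    T (integrand χ GF gk (A + F)) V = T (integrand χ GF gk A) V := by
  refine hloc _ _ fun U hU => ?_
  by_cases hχ : χ U = 0
  · simp [integrand_apply, hχ]
  · simp [integrand_apply, hF U hU hχ]

end Window

/-- ★ **A WINDOW-CONSTANT HISTORY HAS NO RESPONSE** ((2.14): the curly bracket vanishes identically): for `T K k` degree-one homogeneous and LOCAL through the windows
`S W` at `W` and `S₁` at `1`, a history `E` that is CONSTANT `= E(bg_W)` on `S W ∩ supp χ_k` and `= E(bg_1)` on `S₁ ∩ supp χ_k` has
`R_k(A + E)(W) − R_k(A)(W) = −E(bg_1)`, provided the `A`-step's integrals at `W` and at `1` are non-zero (off that junk branch `log 0 = 0` breaks the bookkeeping;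
generalises `PortZD.stepOutT_add_of_vanish`: fibre-constant instead of zero). [cite: Balaban1987RG1, (2.14) p.268, (0.19) p.255–256] -/
theorem stepOutT_add_sub_eq_of_windowConst (T : Transport F N) (χ : (K : ℕ) → (ℕ → ℝ) → (k : ℕ) → Density (F.P K) k (SU N)) (ε : ℝ)
    (K : ℕ) (g : ℕ → ℝ) (k : ℕ) (hT : ∀ (a : ℝ) (ρ : Density (F.P K) k (SU N)), T K k (fun U => a * ρ U) = fun V => a * T K k ρ V)
    {S S₁ : Set (GaugeField (F.P K) k (SU N))} (A E : Density (F.P K) k (SU N)) (W : GaugeField (F.P K) (k + 1) (SU N))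
    (hlocW : ∀ ρ ρ' : Density (F.P K) k (SU N), (∀ U ∈ S, ρ U = ρ' U) → T K k ρ W = T K k ρ' W)
    (hloc1 : ∀ ρ ρ' : Density (F.P K) k (SU N), (∀ U ∈ S₁, ρ U = ρ' U) → T K k ρ 1 = T K k ρ' 1)
    (hAW : T K k (integrand (χ K g k) (gfOfRecord F N K k) (g k) A) W ≠ 0)
    (hA1 : T K k (integrand (χ K g k) (gfOfRecord F N K k) (g k) A) 1 ≠ 0)
    (hEW : ∀ U ∈ S, χ K g k U ≠ 0 → E U = E (Averaging.iter (avOfRecord F N K) k (Uk F N K (k + 1) ε W)))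
    (hE1 : ∀ U ∈ S₁, χ K g k U ≠ 0 → E U = E (Averaging.iter (avOfRecord F N K) k (Uk F N K (k + 1) ε 1))) :
    stepOutT F N T χ ε K g k (A + E) W - stepOutT F N T χ ε K g k A W =
      - E (Averaging.iter (avOfRecord F N K) k (Uk F N K (k + 1) ε 1)) := by
  set cW := E (Averaging.iter (avOfRecord F N K) k (Uk F N K (k + 1) ε W)) with hcW
  set c1 := E (Averaging.iter (avOfRecord F N K) k (Uk F N K (k + 1) ε 1)) with hc1
  have hW : T K k (integrand (χ K g k) (gfOfRecord F N K k) (g k) (A + E)) W =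
      Real.exp cW * T K k (integrand (χ K g k) (gfOfRecord F N K k) (g k) A) W := by
    rw [transport_integrand_add_recentre hT _ _ _ A E cW W,
      transport_integrand_congr_window hlocW _ _ _ A _ fun U hU hχ => by rw [hEW U hU hχ, sub_self]]
  have h1 : T K k (integrand (χ K g k) (gfOfRecord F N K k) (g k) (A + E)) 1 =
      Real.exp c1 * T K k (integrand (χ K g k) (gfOfRecord F N K k) (g k) A) 1 := by
    rw [transport_integrand_add_recentre hT _ _ _ A E c1 1,
      transport_integrand_congr_window hloc1 _ _ _ A _ fun U hU hχ => by rw [hE1 U hU hχ, sub_self]]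
  -- `log((e^{c1} N)⁻¹ (e^{cW} X)) − log(N⁻¹ X) = cW − c1` for `N, X ≠ 0`
  rw [stepOutT_add_sub, nextAction_apply, nextAction_apply, normConst_def, normConst_def, hW, h1, mul_inv, ← Real.exp_neg, mul_mul_mul_comm,
    Real.log_mul (mul_pos (Real.exp_pos _) (Real.exp_pos _)).ne' (mul_ne_zero (inv_ne_zero hA1) hAW),
    Real.log_mul (Real.exp_pos _).ne' (Real.exp_pos _).ne', Real.log_exp, Real.log_exp]
  ring

/-- **`𝓓_{k+1}(W) = 0` FOR A WINDOW-CONSTANT `𝐄_k`** (`= 𝐄_k(bg_W)` on `S W ∩ supp χ_k`, `= 0 = 𝐄_k(1)` on `S₁ ∩ supp χ_k`) with `GaugeInvariant A_k`, the zero-input step's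
integrals non-zero at `W` and `1` (`ε > 0`, `k + 1 ≤ m + K`): (2.14)'s vanishing at zero fluctuation, read fibre-wise. [cite: Balaban1987RG1, (1.6) p.261, (2.14) p.268] -/
theorem dChannel_eq_zero_of_windowConst (T : Transport F N) (χ : (K : ℕ) → (ℕ → ℝ) → (k : ℕ) → Density (F.P K) k (SU N)) {ε : ℝ}
    (hε : 0 < ε) {K : ℕ} (g : ℕ → ℝ) {k : ℕ} (hk : k + 1 ≤ (F.P K).m + (F.P K).K)
    (hT : ∀ (a : ℝ) (ρ : Density (F.P K) k (SU N)), T K k (fun U => a * ρ U) = fun V => a * T K k ρ V)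
    (hinv : GaugeInvariant (effActionHT F N T χ K g k)) {S S₁ : Set (GaugeField (F.P K) k (SU N))} (W : GaugeField (F.P K) (k + 1) (SU N))
    (hlocW : ∀ ρ ρ' : Density (F.P K) k (SU N), (∀ U ∈ S, ρ U = ρ' U) → T K k ρ W = T K k ρ' W)
    (hloc1 : ∀ ρ ρ' : Density (F.P K) k (SU N), (∀ U ∈ S₁, ρ U = ρ' U) → T K k ρ 1 = T K k ρ' 1)
    (h0W : T K k (integrand (χ K g k) (gfOfRecord F N K k) (g k) (mainTermT F N ε K g k)) W ≠ 0)
    (h01 : T K k (integrand (χ K g k) (gfOfRecord F N K k) (g k) (mainTermT F N ε K g k)) 1 ≠ 0)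
    (hEW : ∀ U ∈ S, χ K g k U ≠ 0 → EkT F N T χ ε K g k U = EkT F N T χ ε K g k (Averaging.iter (avOfRecord F N K) k (Uk F N K (k + 1) ε W)))
    (hE1 : ∀ U ∈ S₁, χ K g k U ≠ 0 → EkT F N T χ ε K g k U = 0) :
    mergedTermT F N T χ ε K g k W - zeroInputMergedTermT F N T χ ε K g k W = 0 := by
  have h0 := EkT_iter_Uk_one_of_gaugeInvariant F N T χ hε g hk hinv
  have hE1' : ∀ U ∈ S₁, χ K g k U ≠ 0 →
      EkT F N T χ ε K g k U = EkT F N T χ ε K g k (Averaging.iter (avOfRecord F N K) k (Uk F N K (k + 1) ε 1)) := by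
    intro U hU hχ0; rw [h0]; exact hE1 U hU hχ0
  rw [mergedTermT_eq_stepOut, effActionHT_eq_main_add_Ek_fun F N T χ ε K g k, zeroInputMergedTermT_eq_stepOut,
    stepOutT_add_sub_eq_of_windowConst F N T χ ε K g k hT _ _ W hlocW hloc1 h0W h01 hEW hE1', h0, neg_zero]

/-! ## §3. [II] Lemma 3's mechanism at functional level: a monotone window bounds the channel by the bracket's oscillation -/

section Monotone

variable {P : Params} {G : Type*} {k : ℕ}

/-- Upper squeeze: `T` monotone through the window `S` at `V`, `0 ≤ χ`, `F ≤ η` on `S ∩ supp χ` ⇒ `T(I(A + F))(V) ≤ e^{η} · T(I(A))(V)`.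
[cite: Balaban1988RG2Cluster, Lemma 3 (2.38) p.20 (mechanism; bookkeeping)] -/
theorem transport_integrand_window_le {T : Density P k G → Density P (k + 1) G} {S : Set (GaugeField P k G)} {V : GaugeField P (k + 1) G}
    (hT : ∀ (a : ℝ) (ρ : Density P k G), T (fun U => a * ρ U) = fun V => a * T ρ V)
    (hmono : ∀ ρ ρ' : Density P k G, (∀ U ∈ S, ρ U ≤ ρ' U) → T ρ V ≤ T ρ' V)
    (χ GF : Density P k G) (hχ : ∀ U, 0 ≤ χ U) (gk : ℝ) (A F : Density P k G) {η : ℝ} (hF : ∀ U ∈ S, χ U ≠ 0 → F U ≤ η) :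
    T (integrand χ GF gk (A + F)) V ≤ Real.exp η * T (integrand χ GF gk A) V := by
  have h := congrFun (hT (Real.exp η) (integrand χ GF gk A)) V
  rw [← h]
  refine hmono _ _ fun U hU => ?_
  by_cases hχ0 : χ U = 0
  · simp [integrand_apply, hχ0]
  · rw [integrand_apply, integrand_apply, Pi.add_apply, ← add_assoc, Real.exp_add]
    calc χ U * (Real.exp (-(1 / gk ^ 2) * GF U + A U) * Real.exp (F U))
        ≤ χ U * (Real.exp (-(1 / gk ^ 2) * GF U + A U) * Real.exp η) :=
          mul_le_mul_of_nonneg_left (mul_le_mul_of_nonneg_left (Real.exp_le_exp.2 (hF U hU hχ0)) (Real.exp_pos _).le) (hχ U)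
      _ = Real.exp η * (χ U * Real.exp (-(1 / gk ^ 2) * GF U + A U)) := by ring

/-- Lower squeeze: `−η ≤ F` on `S ∩ supp χ` ⇒ `e^{−η} · T(I(A))(V) ≤ T(I(A + F))(V)`. [cite: Balaban1988RG2Cluster, Lemma 3 (2.38) p.20 (mechanism; bookkeeping)] -/
theorem transport_integrand_window_ge {T : Density P k G → Density P (k + 1) G} {S : Set (GaugeField P k G)} {V : GaugeField P (k + 1) G}
    (hT : ∀ (a : ℝ) (ρ : Density P k G), T (fun U => a * ρ U) = fun V => a * T ρ V)
    (hmono : ∀ ρ ρ' : Density P k G, (∀ U ∈ S, ρ U ≤ ρ' U) → T ρ V ≤ T ρ' V)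
    (χ GF : Density P k G) (hχ : ∀ U, 0 ≤ χ U) (gk : ℝ) (A F : Density P k G) {η : ℝ} (hF : ∀ U ∈ S, χ U ≠ 0 → -η ≤ F U) :
    Real.exp (-η) * T (integrand χ GF gk A) V ≤ T (integrand χ GF gk (A + F)) V := by
  have h := congrFun (hT (Real.exp (-η)) (integrand χ GF gk A)) V
  rw [← h]
  refine hmono _ _ fun U hU => ?_
  by_cases hχ0 : χ U = 0
  · simp [integrand_apply, hχ0]
  · rw [integrand_apply, integrand_apply, Pi.add_apply, ← add_assoc]
    calc Real.exp (-η) * (χ U * Real.exp (-(1 / gk ^ 2) * GF U + A U))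
        = χ U * (Real.exp (-(1 / gk ^ 2) * GF U + A U) * Real.exp (-η)) := by ring
      _ ≤ χ U * (Real.exp (-(1 / gk ^ 2) * GF U + A U) * Real.exp (F U)) :=
          mul_le_mul_of_nonneg_left (mul_le_mul_of_nonneg_left (Real.exp_le_exp.2 (hF U hU hχ0)) (Real.exp_pos _).le) (hχ U)
      _ = χ U * Real.exp (-(1 / gk ^ 2) * GF U + A U + F U) := by rw [← Real.exp_add]

/-- **The log-moment of a window-small bracket is small**: `|F| ≤ η` on `S ∩ supp χ`, `T(I(A))(V) > 0` ⇒ `|log[T(I(A + F))(V) ∕ T(I(A))(V)]| ≤ η`.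
[cite: Balaban1988RG2Cluster, Lemma 3 (2.38) p.20, p.21 (mechanism; bookkeeping)] -/
theorem abs_log_moment_le_of_window {T : Density P k G → Density P (k + 1) G} {S : Set (GaugeField P k G)} {V : GaugeField P (k + 1) G}
    (hT : ∀ (a : ℝ) (ρ : Density P k G), T (fun U => a * ρ U) = fun V => a * T ρ V)
    (hmono : ∀ ρ ρ' : Density P k G, (∀ U ∈ S, ρ U ≤ ρ' U) → T ρ V ≤ T ρ' V)
    (χ GF : Density P k G) (hχ : ∀ U, 0 ≤ χ U) (gk : ℝ) (A F : Density P k G) {η : ℝ} (hF : ∀ U ∈ S, χ U ≠ 0 → |F U| ≤ η)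
    (hA : 0 < T (integrand χ GF gk A) V) :
    |Real.log (T (integrand χ GF gk (A + F)) V / T (integrand χ GF gk A) V)| ≤ η := by
  have hup := transport_integrand_window_le hT hmono χ GF hχ gk A F (fun U hU hχ0 => (abs_le.1 (hF U hU hχ0)).2)
  have hlo := transport_integrand_window_ge hT hmono χ GF hχ gk A F (fun U hU hχ0 => (abs_le.1 (hF U hU hχ0)).1)
  have hpos : 0 < T (integrand χ GF gk (A + F)) V := lt_of_lt_of_le (mul_pos (Real.exp_pos _) hA) hlo
  rw [abs_le]
  constructor
  · rw [← Real.log_exp (-η)]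
    exact Real.log_le_log (Real.exp_pos _) ((le_div_iff₀ hA).2 hlo)
  · rw [← Real.log_exp η]
    exact Real.log_le_log (div_pos hpos hA) ((div_le_iff₀ hA).2 hup)

end Monotone

/-- ★★ **THE HISTORY RESPONSE IS BOUNDED BY THE BRACKET'S OSCILLATION ON THE WINDOWS** ([II] Lemma 3's mechanism, functional level): `T K k` degree-one homogeneous and
MONOTONE through `S W` at `W` and `S₁` at `1`, `0 ≤ χ_k`, the `A`-step defined at `W` and `1`; if `|E(U) − E(bg_W)| ≤ η_W` for `U ∈ S W ∩ supp χ_k` and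
`|E(U) − E(bg_1)| ≤ η_1` for `U ∈ S₁ ∩ supp χ_k`, then `|R_k(A + E)(W) − R_k(A)(W) + E(bg_1)| ≤ η_W + η_1`.  (Print: on the window `|B′| < ε₁` the bracket is
`O(ε₁)`·‖∂𝐄_k‖ — `C₃ε₁`, `C₃ ∝ E₀`; `η` is DISPLAYED here.) [cite: Balaban1988RG2Cluster, Lemma 3 (2.38) p.20, p.21; Balaban1987RG1, (2.12)–(2.14) p.268] -/
theorem abs_stepOutT_add_sub_le_of_window (T : Transport F N) (χ : (K : ℕ) → (ℕ → ℝ) → (k : ℕ) → Density (F.P K) k (SU N)) (ε : ℝ)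
    (K : ℕ) (g : ℕ → ℝ) (k : ℕ) (hT : ∀ (a : ℝ) (ρ : Density (F.P K) k (SU N)), T K k (fun U => a * ρ U) = fun V => a * T K k ρ V)
    (hχ : ∀ U, 0 ≤ χ K g k U) {S S₁ : Set (GaugeField (F.P K) k (SU N))} (A E : Density (F.P K) k (SU N)) (W : GaugeField (F.P K) (k + 1) (SU N))
    (hmonoW : ∀ ρ ρ' : Density (F.P K) k (SU N), (∀ U ∈ S, ρ U ≤ ρ' U) → T K k ρ W ≤ T K k ρ' W)
    (hmono1 : ∀ ρ ρ' : Density (F.P K) k (SU N), (∀ U ∈ S₁, ρ U ≤ ρ' U) → T K k ρ 1 ≤ T K k ρ' 1)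
    (hAW : 0 < T K k (integrand (χ K g k) (gfOfRecord F N K k) (g k) A) W)
    (hA1 : 0 < T K k (integrand (χ K g k) (gfOfRecord F N K k) (g k) A) 1) {ηW η1 : ℝ}
    (hEW : ∀ U ∈ S, χ K g k U ≠ 0 → |E U - E (Averaging.iter (avOfRecord F N K) k (Uk F N K (k + 1) ε W))| ≤ ηW)
    (hE1 : ∀ U ∈ S₁, χ K g k U ≠ 0 → |E U - E (Averaging.iter (avOfRecord F N K) k (Uk F N K (k + 1) ε 1))| ≤ η1) :
    |stepOutT F N T χ ε K g k (A + E) W - stepOutT F N T χ ε K g k A W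
        + E (Averaging.iter (avOfRecord F N K) k (Uk F N K (k + 1) ε 1))| ≤ ηW + η1 := by
  set cW := E (Averaging.iter (avOfRecord F N K) k (Uk F N K (k + 1) ε W)) with hcW
  set c1 := E (Averaging.iter (avOfRecord F N K) k (Uk F N K (k + 1) ε 1)) with hc1
  -- the two re-centred steps are defined (lower squeeze), so §1's identity applies
  have hloW := transport_integrand_window_ge hT hmonoW (χ K g k) (gfOfRecord F N K k) hχ (g k) A (fun U => E U - cW)
    (fun U hU hχ0 => (abs_le.1 (hEW U hU hχ0)).1)
  have hlo1 := transport_integrand_window_ge hT hmono1 (χ K g k) (gfOfRecord F N K k) hχ (g k) A (fun U => E U - c1)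
    (fun U hU hχ0 => (abs_le.1 (hE1 U hU hχ0)).1)
  have hXW : 0 < T K k (integrand (χ K g k) (gfOfRecord F N K k) (g k) (A + fun U => E U - cW)) W :=
    lt_of_lt_of_le (mul_pos (Real.exp_pos _) hAW) hloW
  have hX1 : 0 < T K k (integrand (χ K g k) (gfOfRecord F N K k) (g k) (A + fun U => E U - c1)) 1 :=
    lt_of_lt_of_le (mul_pos (Real.exp_pos _) hA1) hlo1
  have hEW' : 0 < T K k (integrand (χ K g k) (gfOfRecord F N K k) (g k) (A + E)) W := by
    rw [transport_integrand_add_recentre hT _ _ _ A E cW W]; exact mul_pos (Real.exp_pos _) hXW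
  have hE1' : 0 < T K k (integrand (χ K g k) (gfOfRecord F N K k) (g k) (A + E)) 1 := by
    rw [transport_integrand_add_recentre hT _ _ _ A E c1 1]; exact mul_pos (Real.exp_pos _) hX1
  rw [stepOutT_add_sub_eq_log_fluct F N T χ ε K g k hT A E W hAW hA1 hEW' hE1', sub_add_cancel]
  have h₁ := abs_log_moment_le_of_window hT hmonoW (χ K g k) (gfOfRecord F N K k) hχ (g k) A (fun U => E U - cW) hEW hAW
  have h₂ := abs_log_moment_le_of_window hT hmono1 (χ K g k) (gfOfRecord F N K k) hχ (g k) A (fun U => E U - c1) hE1 hA1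
  exact (abs_sub _ _).trans (add_le_add h₁ h₂)

/-- ★★ **`|𝓓_{k+1}(W)| ≤ η_W + η_1`** — the history channel is bounded by the oscillation of `𝐄_k − 𝐄_k(background)` on the windows at `W` and at `1`, given
`GaugeInvariant A_k` (unit normalisation), `0 ≤ χ_k`, `T K k` homogeneous and window-monotone, and the zero-input step defined at `W` and `1` (`ε > 0`, `k + 1 ≤ m + K`).
[cite: Balaban1988RG2Cluster, Lemma 3 (2.38) p.20, p.21; Balaban1987RG1, (1.6) p.261, (2.12)–(2.14) p.268] -/
theorem abs_dChannel_le_of_window (T : Transport F N) (χ : (K : ℕ) → (ℕ → ℝ) → (k : ℕ) → Density (F.P K) k (SU N)) {ε : ℝ} (hε : 0 < ε)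
    {K : ℕ} (g : ℕ → ℝ) {k : ℕ} (hk : k + 1 ≤ (F.P K).m + (F.P K).K)
    (hT : ∀ (a : ℝ) (ρ : Density (F.P K) k (SU N)), T K k (fun U => a * ρ U) = fun V => a * T K k ρ V)
    (hχ : ∀ U, 0 ≤ χ K g k U) (hinv : GaugeInvariant (effActionHT F N T χ K g k)) {S S₁ : Set (GaugeField (F.P K) k (SU N))}
    (W : GaugeField (F.P K) (k + 1) (SU N))
    (hmonoW : ∀ ρ ρ' : Density (F.P K) k (SU N), (∀ U ∈ S, ρ U ≤ ρ' U) → T K k ρ W ≤ T K k ρ' W)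
    (hmono1 : ∀ ρ ρ' : Density (F.P K) k (SU N), (∀ U ∈ S₁, ρ U ≤ ρ' U) → T K k ρ 1 ≤ T K k ρ' 1)
    (h0W : 0 < T K k (integrand (χ K g k) (gfOfRecord F N K k) (g k) (mainTermT F N ε K g k)) W)
    (h01 : 0 < T K k (integrand (χ K g k) (gfOfRecord F N K k) (g k) (mainTermT F N ε K g k)) 1) {ηW η1 : ℝ}
    (hEW : ∀ U ∈ S, χ K g k U ≠ 0 →
      |EkT F N T χ ε K g k U - EkT F N T χ ε K g k (Averaging.iter (avOfRecord F N K) k (Uk F N K (k + 1) ε W))| ≤ ηW)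
    (hE1 : ∀ U ∈ S₁, χ K g k U ≠ 0 → |EkT F N T χ ε K g k U - EkT F N T χ ε K g k 1| ≤ η1) :
    |mergedTermT F N T χ ε K g k W - zeroInputMergedTermT F N T χ ε K g k W| ≤ ηW + η1 := by
  have h0 := EkT_iter_Uk_one_of_gaugeInvariant F N T χ hε g hk hinv
  have hE1' : ∀ U ∈ S₁, χ K g k U ≠ 0 →
      |EkT F N T χ ε K g k U - EkT F N T χ ε K g k (Averaging.iter (avOfRecord F N K) k (Uk F N K (k + 1) ε 1))| ≤ η1 := by
    intro U hU hχ0; rw [h0, ← EkT_one F N T χ hε K g k]; exact hE1 U hU hχ0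
  have h := abs_stepOutT_add_sub_le_of_window F N T χ ε K g k hT hχ (mainTermT F N ε K g k) (EkT F N T χ ε K g k) W hmonoW hmono1
    h0W h01 hEW hE1'
  rwa [h0, add_zero, ← effActionHT_eq_main_add_Ek_fun F N T χ ε K g k, ← mergedTermT_eq_stepOut, ← zeroInputMergedTermT_eq_stepOut] at h

end Summit.QuantumFields.YangMills.Theorems.PortZD

end
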